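import Mathlib
import Literature.Analysis.FluidPDE.Axisymmetric
import Literature.Analysis.FluidPDE.KNSSNoAxisymmetricTypeIHolds
import Summits.NavierStokesRegularity.NavierStokesRegularity.Theorems.PlaneEnergyCeilingPlanarEnergyAPrioriClosedSlab
import Summits.NavierStokesRegularity.NavierStokesRegularity.Theorems.Target.Negative.CounterexampleProfile

/-!
# Route PlaneEnergyCeiling · crux `PlanarEnergyAPriori` — the axisymmetric Type-I corner

Helper file for the crux item stmt-NavierStokesRegularity-16855 (`PlanarEnergyAPriori`, route
`PlaneEnergyCeiling`), landed `--supports` that item: a second calibration corner of the crux, in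
the direction the strategist census (gen 1, A-S6) singles out — "in the Leray-rate (Type-I) class
the crux is one logarithm away from a theorem". FOR AXISYMMETRIC SOLUTIONS THAT LOGARITHM IS A
THEOREM: along every classical solution of unforced Navier–Stokes on `ℝ³ × [0,T)` that is
Leray–Hopf from a rapidly decaying datum, axisymmetric at all times, and either Type-I at `T`
(`‖u(t,x)‖ ≤ C/√(T−t)` near `T`) or with `r‖u‖ ≤ C`, the planar kinetic energies are bounded
uniformly in `t < T`, the direction and the offset (`planarCeiling_of_axisymmetric_typeI`).

Proof: boundedness on every closed sub-slab `[0,T']` (landed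
`Theorems.Target.Negative.pointwise_bounded_before`: Sobolev bounds on closed slabs + imbedding), then the
discharged Koch–Nadirashvili–Seregin–Šverák theorem `knss_no_axisymmetric_typeI_holds` (no
axisymmetric Type-I blow-up: the solution extends smoothly past `T`), and the landed
`planarCeiling_of_hasSmoothExtensionPast` (seat 1, `…ClosedSlab.lean`). Folklore assembly of
accepted facts.
-/

noncomputable section

-- single-conjunct summit: `Summit.<Summit>.<Problem>` repeats the name by the D-0017 layout
set_option linter.dupNamespace false

namespace Summit.NavierStokesRegularity.NavierStokesRegularity.Theorems.PlanarEnergyAPriori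

open MeasureTheory Set Filter Topology Function WithLp
open scoped ENNReal NNReal
open Literature.Analysis.FluidPDE

variable {ν T : ℝ} {u : ℝ → EuclideanSpace ℝ (Fin 3) → EuclideanSpace ℝ (Fin 3)} {p : ℝ → EuclideanSpace ℝ (Fin 3) → ℝ}

/-- **THE CRUX IN THE AXISYMMETRIC TYPE-I CORNER.** Along every classical solution of unforced
Navier–Stokes on `ℝ³ × [0,T)` (`ν, T > 0`) that is Leray–Hopf from a rapidly decaying datum,
axisymmetric at all times `t < T`, and either Type-I at `T` or with `r‖u‖ ≤ C` on `[0,T)`, the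
planar kinetic energies `∫_{R{x₂=c}} |u(t)|² dA` are bounded uniformly in `t < T`, `R`, `c`
(Koch–Nadirashvili–Seregin–Šverák 2009, discharged in the tree). [folklore] -/
theorem planarCeiling_of_axisymmetric_typeI (hν : 0 < ν) (hT : 0 < T)
    (hcl : IsClassicalNSSolutionOn (Ico 0 T) ν 0 u p) (hLH : IsLerayHopfOn T ν 0 (u 0) u)
    (hdec : HasRapidSpatialDecay (u 0)) (haxi : ∀ t ∈ Ico 0 T, IsAxisymmetric (u t))
    (htypeI : IsTypeIBlowup u T ∨ ∃ C : ℝ, ∀ t ∈ Ico 0 T, ∀ x, cylRadius x * ‖u t x‖ ≤ C) :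
    ∃ M : ℝ, ∀ t ∈ Ico 0 T, ∀ (R : EuclideanSpace ℝ (Fin 3) ≃ₗᵢ[ℝ] EuclideanSpace ℝ (Fin 3)) (c : ℝ),
      ∫⁻ y : EuclideanSpace ℝ (Fin 2), ‖u t (R (toLp 2 ![y 0, y 1, c]))‖ₑ ^ 2 ≤ ENNReal.ofReal M :=
  planarCeiling_of_hasSmoothExtensionPast hν hT hcl hLH hdec
    (knss_no_axisymmetric_typeI_holds hν hT hcl hLH
      (Summit.NavierStokesRegularity.NavierStokesRegularity.Theorems.Target.Negative.pointwise_bounded_before hν hcl hLH hdec)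
      haxi htypeI)

/-- **The crux in the axisymmetric Type-I corner, registered closed form** (sub-goal
`planarCeiling_of_axisymmetric_typeI_closedForm` of stmt-NavierStokesRegularity-16855). [folklore] -/
theorem planarCeiling_of_axisymmetric_typeI_closedForm : ∀ (ν T : ℝ), 0 < ν → 0 < T → ∀ (u : ℝ → EuclideanSpace ℝ (Fin 3) → EuclideanSpace ℝ (Fin 3)) (p : ℝ → EuclideanSpace ℝ (Fin 3) → ℝ), Literature.Analysis.FluidPDE.IsClassicalNSSolutionOn (Set.Ico 0 T) ν 0 u p → Literature.Analysis.FluidPDE.IsLerayHopfOn T ν 0 (u 0) u → Literature.Analysis.FluidPDE.HasRapidSpatialDecay (u 0) → (∀ t ∈ Set.Ico 0 T, Literature.Analysis.FluidPDE.IsAxisymmetric (u t)) → (Literature.Analysis.FluidPDE.IsTypeIBlowup u T ∨ ∃ C : ℝ, ∀ t ∈ Set.Ico 0 T, ∀ x, Literature.Analysis.FluidPDE.cylRadius x * ‖u t x‖ ≤ C) → ∃ M : ℝ, ∀ t ∈ Set.Ico 0 T, ∀ (R : EuclideanSpace ℝ (Fin 3) ≃ₗᵢ[ℝ] EuclideanSpace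 ℝ (Fin 3)) (c : ℝ), ∫⁻ y : EuclideanSpace ℝ (Fin 2), ‖u t (R (WithLp.toLp 2 ![y 0, y 1, c]))‖ₑ ^ 2 ≤ ENNReal.ofReal M :=
  fun _ _ hν hT _ _ hcl hLH hdec haxi htypeI => planarCeiling_of_axisymmetric_typeI hν hT hcl hLH hdec haxi htypeI

end Summit.NavierStokesRegularity.NavierStokesRegularity.Theorems.PlanarEnergyAPriori

end
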